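import Mathlib
import Literature.NumberTheory.Sieve.Maynard2016Lemma7ErrorBound
import HarnessLib

/-!
# Maynard (2016), Lemma 7: the error-term half, packaged ((6.27)–(6.31))

Topic `Literature/NumberTheory/Sieve`; trunk AntSieve / parity (Maynard 2016 large-gaps ladder, named
fact `Literature.NumberTheory.Sieve.Maynard2016.Lemma7Tuple` of `Maynard2016Lemma7PerTuple.lean`).

J. Maynard, *Large gaps between primes*, Ann. of Math. (2) 183 (2016), 915–933 = arXiv:1408.5110,
§6, proof of Lemma 7, displays (6.27)–(6.31): after expanding the square and interchanging
summations, the `q`-sum is a count of primes in ONE residue class per contributing tuple; "the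
error terms can be bounded using the Bombieri–Vinogradov theorem … and so contribute
`O_A(x (log x)^{−A})`", leaving the main term `#𝓘 · Σ_{tuples} λλ'/φ(modulus)` ((6.32)).

PROVED here (no named facts) — the one-line interface for the error-term half:
* `solvSum` — `S_i := Σ_{(d,d',e,e') ∈ rbox_i⁴, SysSolvable} λ_{d,e} λ_{d',e'}/φ(radMod)`, the
  normalised main-term sum of (6.32);
* `sum_mainCoeff_eq` — `Σ_{rbox_i⁴} λλ' · mainCoeff(N) = N · S_i`;
* `eventually_lemma7_sideConditions` — for large `x`: `1 ≤ x`, `0 < log x`, `0 < log y`, `y ≤ x`;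
* `exists_eventually_abs_sum_divSum_sq_sub_le` — **∃ C, for all large `x`, all `m ≥ 1`, primes
  `p₀ > x` with `(m p₀ − 1, P_y) = 1`, all `i`, all `1 ≤ A ≤ B ≤ x` with `h_i q < p₀` on `𝓘`:
  `|Σ_{q ∈ 𝓘} divSum(q)(p₀ − h_i q)² − #𝓘 · S_i| ≤ C x/(log x)^A`** (assembles
  `abs_sum_divSum_sq_sub_main_le`, `exists_eventually_errorSum_le`, `eventually_isCoprime_hTuple_sub`).

## References

* J. Maynard, *Large gaps between primes*, Ann. of Math. (2) 183 (2016), 915–933; arXiv:1408.5110,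
  §6, proof of Lemma 7, displays (6.27)–(6.32). [Maynard2016LargeGaps]
-/

noncomputable section

open Finset Filter
open scoped BigOperators

namespace Literature.NumberTheory.Sieve

namespace Maynard2016

variable {k : ℕ}

/-! ### The main-term sum `S_i` -/

open Classical in
/-- `S_i := Σ_{(d,d',e,e') ∈ rbox_i⁴, SysSolvable} λ_{d,e} λ_{d',e'}/φ(radMod(d,d',e,e'))` (the tuple sum
of display (6.32), main term of the `q`-sum divided by `#𝓘`). [cite: Maynard2016LargeGaps, Lemma 7 (proof, display (6.32))] -/
def solvSum {J : ℕ} (c : Fin J → ℝ) (Fd : Fin k → Fin J → ℝ → ℝ) (G : ℝ → ℝ) (ε : ℝ)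
    (x m p₀ : ℕ) (i : Fin k) : ℝ :=
  ∑ d ∈ rbox k x i, ∑ d' ∈ rbox k x i, ∑ e ∈ rbox k x i, ∑ e' ∈ rbox k x i,
    if SysSolvable k x m p₀ i d d' e e' then
      lam c Fd G ε x d e * lam c Fd G ε x d' e' / (Nat.totient (radMod d d' e e') : ℝ)
    else 0

/-- `Σ_{rbox_i⁴} λλ' · mainCoeff(N) = N · S_i`. [cite: Maynard2016LargeGaps, Lemma 7 (proof, display (6.32))] -/
theorem sum_mainCoeff_eq {J : ℕ} (c : Fin J → ℝ) (Fd : Fin k → Fin J → ℝ → ℝ) (G : ℝ → ℝ)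
    (ε : ℝ) (x m p₀ : ℕ) (i : Fin k) (N : ℝ) :
    ∑ d ∈ rbox k x i, ∑ d' ∈ rbox k x i, ∑ e ∈ rbox k x i, ∑ e' ∈ rbox k x i,
        lam c Fd G ε x d e * lam c Fd G ε x d' e' * mainCoeff k x m p₀ i d d' e e' N =
      N * solvSum c Fd G ε x m p₀ i := by
  classical
  unfold solvSum
  simp only [Finset.mul_sum]
  refine Finset.sum_congr rfl fun d _ => Finset.sum_congr rfl fun d' _ =>
    Finset.sum_congr rfl fun e _ => Finset.sum_congr rfl fun e' _ => ?_
  unfold mainCoeff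
  split_ifs <;> ring

/-! ### Side conditions for large `x` -/

/-- For `0 ≤ ε ≤ 1/2` and large `x`: `1 ≤ x`, `0 < log x`, `0 < log y`, `y ≤ x`. [cite: Maynard2016LargeGaps, §2 display (2.1)] -/
theorem eventually_lemma7_sideConditions {ε : ℝ} (hε0 : 0 ≤ ε) (hε : ε ≤ 1 / 2) :
    ∀ᶠ x : ℕ in atTop, 1 ≤ x ∧ 0 < Real.log x ∧ 0 < Real.log (y ε x) ∧ y ε x ≤ x := by
  filter_upwards [eventually_iteratedLogs, eventually_ge_atTop 1] with x hx hx1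
  obtain ⟨hL, hL₂, hL₃, hL₃₂, hL₂L, -, -⟩ := hx
  have hlogx : 0 < Real.log x := by linarith
  have hlogy : 0 < Real.log (y ε x) := log_y_pos hε (by linarith) (by linarith) hL₃
  have hx0 : (0 : ℝ) < x := by exact_mod_cast hx1
  refine ⟨hx1, hlogx, hlogy, ?_⟩
  have h1 : Real.log (y ε x) ≤ Real.log x :=
    log_y_le_log hε0 (by linarith) hlogx.le (by linarith) (by linarith)
  exact (Real.log_le_log_iff (Real.exp_pos _) hx0).1 h1

/-! ### The packaged error-term estimate -/

/-- **The error-term half of Lemma 7, packaged:** there is `C` such that for all large `x`, all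
`m ≥ 1`, all primes `p₀ > x` with `(m p₀ − 1, P_y) = 1`, all `i`, and all `1 ≤ A ≤ B ≤ x` with
`h_i q < p₀` for `q ∈ 𝓘 = [A, B] ∩ primes`,
`|Σ_{q ∈ 𝓘} divSum(q)(p₀ − h_i q)² − #𝓘 · S_i| ≤ C x/(log x)^A`. [cite: Maynard2016LargeGaps, Lemma 7 (proof, displays (6.27)–(6.32))] -/
theorem exists_eventually_abs_sum_divSum_sq_sub_le {J : ℕ} {c : Fin J → ℝ}
    {Fd : Fin k → Fin J → ℝ → ℝ} {G : ℝ → ℝ} (hD : IsSieveData k J c Fd G) {ε : ℝ}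
    (hε0 : 0 ≤ ε) (hε : ε ≤ 1 / 2) {A : ℝ} (hA : 0 < A) :
    ∃ C : ℝ, ∀ᶠ x : ℕ in atTop, ∀ m p₀ : ℕ, 1 ≤ m → p₀.Prime → x < p₀ →
      Nat.Coprime (m * p₀ - 1) (primorial ⌊y ε x⌋₊) → ∀ i : Fin k, ∀ A' B' : ℝ,
        1 ≤ A' → A' ≤ B' → B' ≤ x → (∀ q ∈ intervalPrimes A' B', hTuple k x i * q < p₀) →
          |∑ q ∈ intervalPrimes A' B', divSum c Fd G ε x m q (p₀ - hTuple k x i * q) ^ 2 -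
              ((intervalPrimes A' B').card : ℝ) * solvSum c Fd G ε x m p₀ i| ≤
            C * x / Real.log x ^ A := by
  obtain ⟨C, hC⟩ := exists_eventually_errorSum_le hD hε0 hε hA
  refine ⟨C, ?_⟩
  filter_upwards [hC, eventually_isCoprime_hTuple_sub k hε, eventually_lemma7_sideConditions hε0 hε]
    with x hx hiso hside m p₀ hm hp₀ hxp hcop i A' B' hA' hAB hBx hQ
  obtain ⟨hx1, hlogx, hlogy, hyx⟩ := hside
  have hmp : 1 ≤ m * p₀ := Nat.one_le_iff_ne_zero.2 (Nat.mul_ne_zero (by omega) hp₀.ne_zero)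
  have hacop : ∀ j, j ≠ i → IsCoprime ((m : ℤ) * p₀ - 1) ((hTuple k x j : ℤ) - hTuple k x i) :=
    fun j hj => hiso m p₀ hmp hcop i j hj
  rw [← sum_mainCoeff_eq]
  exact (abs_sum_divSum_sq_sub_main_le hD hx1 hlogx hlogy hyx hm hp₀ hxp hcop hacop hA' hAB hBx
    hQ).trans (hx i)

end Maynard2016

end Literature.NumberTheory.Sieve

end
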